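import Literature.Analysis.FluidPDE.AxisymHouLiVariables
import Literature.Analysis.FluidPDE.AxisymmetricVorticityTransport
import Literature.Analysis.FluidPDE.ClassicalSolutionCalculus
import Literature.Analysis.FluidPDE.EnergyToolkit
import Literature.Analysis.FluidPDE.HessianLaplacian
import Literature.Analysis.FluidPDE.AxisymVorticityAlgebra
import HarnessLib

/-!
# The equations of `Φ = u^θ/r` and `Ω = ω^θ/r` for axisymmetric Navier–Stokes flows
# (Lei–Zhang 2017, (1.3)–(1.4); Hou–Li 2008, §2), as identities of smooth functions on `ℝ³`

Analysis/FluidPDE proof file (theorems only; no definitions, no named facts) on the discharge path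
of the named facts `Literature.Analysis.FluidPDE.LeiZhang2017_logModulus_regularity`
(Cor. 1.3), `…LeiZhang2017_smallSwirl_regularity` (Thm. 1.4) and
`…Wei2016_logModulus_regularity` (Wei 2016, Cor. 1.1), all of which run energy estimates on

> `∂ₜ(v^θ/r)`-type equations: "One can easily check that `∂ₜΓ + (vʳe_r + vᶻe_z)·∇Γ =
> (Δ − (2/r)∂ᵣ)Γ`" (Lei–Zhang 2017, (1.3)), and "we also study the equations for `J` and `Ω`:
> `∂ₜJ + (b·∇)J = (Δ + (2/r)∂ᵣ)J + (ωʳ∂ᵣ + ωᶻ∂_z)(vʳ/r)`,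
> `∂ₜΩ + (b·∇)Ω = (Δ + (2/r)∂ᵣ)Ω − 2 (v^θ/r) J`" (ibid. (1.4); `b = vʳe_r + vᶻe_z`,
> `Ω = ω^θ/r`, `J = −∂_z v^θ/r = ωʳ/r`; Wei 2016, (1.5); Chen–Fang–Zhang 2017).

With the smooth Hou–Li variables of the tree (`AxisymHouLiVariables.lean`, all smooth ACROSS
the axis): `Φ = angVelQuot u = u^θ/r = Γ/r²`, `Ω = angVortQuot u = ω^θ/r`,
`W = radVelQuot u = uʳ/r`, `J = radVelQuot (curl u) = ωʳ/r`, and the smooth radial derivative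
`radDerivQuot S = (∂ᵣS)/r` (`AxisymRadialQuotient.lean`), this file proves, for a classical
solution `(u, p)` of the unforced system with viscosity `ν` on a time set `S` with axisymmetric
velocity, at EVERY point `x ∈ ℝ³` (axis included) and every `t ∈ S`:

* `IsClassicalNSSolutionOn.angVelQuot_eq` — **the `Φ`-equation**
  `Φ' + DΦ[u] = ν (ΔΦ + 2 radDerivQuot Φ) − 2 W Φ`, i.e.
  `∂ₜ(v^θ/r) + (b·∇)(v^θ/r) = (Δ + (2/r)∂ᵣ)(v^θ/r) − 2 (vʳ/r)(v^θ/r)` (Hou–Li's `u₁`-equation;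
  the `r⁻²`-multiple of (1.3)), where `Φ' = angVelQuot (∂ₜu)` is the smooth quotient of
  `∂ₜΓ = swirl (∂ₜu)` (`∂ₜ = timeDerivWithin S`);
* (sequel file) **the `Ω`-equation** (1.4)₂ `Ω' + DΩ[u] = ν (ΔΩ + 2 radDerivQuot Ω) − 2 Φ J`,
  `Ω' = angVortQuot (∂ₜu)`, is obtained in the same way from
  `IsClassicalNSSolutionOn.swirl_vorticity_transport` with the template below and the Lagrange
  identity `2⟪J u, ω⟫ = 2ρ (W Ω − Φ J)`; it is NOT in this file.

The `Φ`-equation is derived from the transport equation of `Γ = r u^θ` (`swirl_transport_holds`,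
KNSS (1.8)) by the pointwise **template** `template_quotient_eq`: if `Σ = ρ σ` with `ρ = x₀² + x₁² = r²` satisfies
`Σ' + DΣ[c] = ν (ΔΣ − (2/ρ) DΣ[x_h]) + R` at a point off the axis, then
`σ' + Dσ[c] + 2σ ⟪x_h, c⟫/ρ = ν (Δσ + (2/ρ) Dσ[x_h]) + R/ρ` there
(`D(ρσ) = 2σ⟪x_h, ·⟫ + ρ Dσ`, `Δ(ρσ) = ρΔσ + 4σ + 4 Dσ[x_h]`, `Dρ[x_h] = 2ρ`, `Δρ = 4`); the
extra term is `2σ (x₀c₀ + x₁c₁)/ρ = 2 σ W` (for `c = u`).  The identity is first obtained off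
the axis (`angVelQuot_eq_of_ne`) and then extended to the axis by continuity (all terms are
smooth functions on `ℝ³`; `eq_of_eq_off_ker`).  Also recorded: the time derivative of an
axisymmetric jointly smooth field is axisymmetric with smooth slices
(`IsSmoothSpaceTimeOn.isAxisymmetric_timeDerivWithin`, `.contDiff_timeDerivWithin_slice`),
`∂ₜΓ = swirl (∂ₜu)` (`.timeDerivWithin_swirl_eq_swirl`), and the calculus of `ρ = x₀² + x₁²`
(`fderiv_rho_apply`, `laplacian_rho`, `sum_fderiv_rho_mul_fderiv`; `contDiff_horizSq`, `sq_add_sq_eq_cylRadius_sq` are the tree's).  The `J`-equation (1.4)₁ is not needed in pointwise form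
by the energy method (`J = −∂_z Φ` and (1.4)₁ is the `z`-derivative of the `Φ`-equation) and is
not derived here.

## Mathlib / tree search

Tree: `angVelQuot`, `angVortQuot`, `radVelQuot`, `radDerivQuot`, `radQuot` and their API
(`AxisymHouLiVariables`, `AxisymRadialQuotient`, seat of `LeiZhang2017_smallSwirl_regularity`);
`swirl_transport_holds`, `timeDerivWithin_swirl`, `laplacian_swirl`, `rotGen_eq_sub_single`,
`IsAxisymmetric.partialDeriv_eR_swirl`, `IsAxisymmetric.fderiv_rotGen` (`SwirlTransportProofs`);
`IsClassicalNSSolutionOn.isAxisymmetricScalar_pressure` (`AxisymmetricVorticityTransport`); `laplacian_mul_eq`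
(`HessianLaplacian`); `IsSmoothSpaceTimeOn.timeDerivWithin`,
`IsSmoothSpaceTimeOn.timeDerivWithin_fderiv_slice_apply` (`ClassicalSolutionCalculus`,
`EnergyToolkit`); `eq_of_eq_off_ker` (`AxisymmetricLiftR5`).
`lean search 'angVelQuot_eq|template_quotient'`: nothing before this file.

## References

* Z. Lei, Q. S. Zhang, Pacific J. Math. 289 (2017) 169–187, arXiv:1505.02628, §1, (1.3)–(1.4)
  (arXiv pp. 3–4). [`LeiZhang2017`]
* D. Wei, J. Math. Anal. Appl. 435 (2016) 402–413, arXiv:1508.03318, (1.5). [`Wei2016`]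
* T. Y. Hou, C. Li, Comm. Pure Appl. Math. 61 (2008) 661–697, §2 (the `u₁`, `ω₁` equations).
* H. Chen, D. Fang, T. Zhang, DCDS 37 (2017) 1923–1939 (the `(J, Ω)` system). [`ChenFangZhang2017`]
-/

noncomputable section

open MeasureTheory Set Function Filter Topology InnerProductSpace
open scoped RealInnerProductSpace Laplacian ContDiff

namespace Literature.Analysis.FluidPDE

/-! ### The weight `ρ = x₀² + x₁² = r²`: gradient and Laplacian -/

section Rho

/-- `ρ (y) = y₀² + y₁²` has derivative `Dρ(y) h = 2 (y₀h₀ + y₁h₁)`. This is the tree's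
`hasFDerivAt_horizSq` (`AxisymVorticityAlgebra.lean`); the name is kept for its users
(`fderiv_rho_apply` here, `AxisymPhiFourEnergy`, `Wei2016AngVelQuotWeighted`,
`AxisymSwirlCutoffEnergy`). [folklore] -/
theorem hasFDerivAt_rho (y : EuclideanSpace ℝ (Fin 3)) :
    HasFDerivAt (fun y : EuclideanSpace ℝ (Fin 3) => y 0 ^ 2 + y 1 ^ 2)
      ((2 * y 0) • (EuclideanSpace.proj (0 : Fin 3) : EuclideanSpace ℝ (Fin 3) →L[ℝ] ℝ) +
        (2 * y 1) • (EuclideanSpace.proj (1 : Fin 3) : EuclideanSpace ℝ (Fin 3) →L[ℝ] ℝ)) y :=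
  hasFDerivAt_horizSq y

/-- `Dρ(y) h = 2 (y₀h₀ + y₁h₁)`. This is the tree's `fderiv_horizSq_apply`
(`AxisymVorticityAlgebra.lean`); the name is kept for its users in 9 files. [folklore] -/
theorem fderiv_rho_apply (y h : EuclideanSpace ℝ (Fin 3)) :
    fderiv ℝ (fun y : EuclideanSpace ℝ (Fin 3) => y 0 ^ 2 + y 1 ^ 2) y h =
      2 * (y 0 * h 0 + y 1 * h 1) :=
  fderiv_horizSq_apply y h

/-- The linear form `y ↦ 2 (y₀e₀ + y₁e₁)` has constant derivative; second derivatives of `ρ`: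
`D(y ↦ Dρ(y) e)(x) e = 2 (e₀² + e₁²)`. [folklore] -/
theorem fderiv_fderiv_rho_apply (x e : EuclideanSpace ℝ (Fin 3)) :
    fderiv ℝ (fun y : EuclideanSpace ℝ (Fin 3) =>
      fderiv ℝ (fun y : EuclideanSpace ℝ (Fin 3) => y 0 ^ 2 + y 1 ^ 2) y e) x e =
      2 * (e 0 * e 0 + e 1 * e 1) := by
  have hfun : (fun y : EuclideanSpace ℝ (Fin 3) =>
      fderiv ℝ (fun y : EuclideanSpace ℝ (Fin 3) => y 0 ^ 2 + y 1 ^ 2) y e) =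
      fun y => 2 * (y 0 * e 0 + y 1 * e 1) := funext fun y => fderiv_rho_apply y e
  rw [hfun]
  have h : HasFDerivAt (fun y : EuclideanSpace ℝ (Fin 3) => 2 * (y 0 * e 0 + y 1 * e 1))
      ((2 * e 0) • (EuclideanSpace.proj (0 : Fin 3) : EuclideanSpace ℝ (Fin 3) →L[ℝ] ℝ) +
        (2 * e 1) • (EuclideanSpace.proj (1 : Fin 3) : EuclideanSpace ℝ (Fin 3) →L[ℝ] ℝ)) x := by
    have h0 := ((EuclideanSpace.proj (𝕜 := ℝ) (0 : Fin 3)).hasFDerivAt (x := x)).mul_const (e 0)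
    have h1 := ((EuclideanSpace.proj (𝕜 := ℝ) (1 : Fin 3)).hasFDerivAt (x := x)).mul_const (e 1)
    have h2 := (h0.add h1).const_mul (2 : ℝ)
    refine h2.congr_fderiv ?_
    ext v
    simp
    ring
  rw [h.fderiv]
  simp
  ring

/-- `Δρ = 4` on `ℝ³`. [folklore] -/
theorem laplacian_rho (x : EuclideanSpace ℝ (Fin 3)) :
    (Δ (fun y : EuclideanSpace ℝ (Fin 3) => y 0 ^ 2 + y 1 ^ 2)) x = 4 := by
  classical
  set b := EuclideanSpace.basisFun (Fin 3) ℝ with hb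
  have hb' : ∀ i, b i = EuclideanSpace.single i 1 := fun i => by simp [hb]
  rw [laplacian_eq_sum_fderiv_fderiv b (contDiff_horizSq (n := 2)) x]
  simp only [fderiv_fderiv_rho_apply, Fin.sum_univ_three, hb']
  simp
  norm_num

/-- The Leibniz cross term `Σᵢ ∂ᵢρ ∂ᵢσ = 2 Dσ[x_h]`. [folklore] -/
theorem sum_fderiv_rho_mul_fderiv (σ : EuclideanSpace ℝ (Fin 3) → ℝ) (x : EuclideanSpace ℝ (Fin 3)) :
    ∑ i, fderiv ℝ (fun y : EuclideanSpace ℝ (Fin 3) => y 0 ^ 2 + y 1 ^ 2) x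
        (EuclideanSpace.basisFun (Fin 3) ℝ i) * fderiv ℝ σ x (EuclideanSpace.basisFun (Fin 3) ℝ i) =
      2 * fderiv ℝ σ x ((x 0) • EuclideanSpace.single 0 1 + (x 1) • EuclideanSpace.single 1 1) := by
  have hb' : ∀ i, EuclideanSpace.basisFun (Fin 3) ℝ i = EuclideanSpace.single i 1 := fun i => by simp
  simp only [fderiv_rho_apply, Fin.sum_univ_three, hb', map_add, map_smul, smul_eq_mul]
  simp
  ring

end Rho

/-! ### The template: from the equation of `Σ = ρ σ` to the equation of `σ` -/

section Template

/-- **Template** for the passage from `Γ`-type to `Γ/r²`-type equations.  Let `σ ∈ C²(ℝ³)`,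
`ρ = y₀² + y₁²`, and suppose that at a point `x` off the axis the product `Σ = ρ σ` satisfies
`Σ' + DΣ(x)[c] = ν (ΔΣ(x) − (2/ρ) DΣ(x)[x_h]) + R` for some numbers `Σ' = ρ(x) σ'`, `R` and a
vector `c`.  Then `σ' + Dσ(x)[c] + 2 σ(x) (x₀c₀ + x₁c₁)/ρ(x) = ν (Δσ(x) + (2/ρ) Dσ(x)[x_h]) + R/ρ(x)`.
(`D(ρσ) = 2σ⟪x_h, ·⟫ + ρDσ`, `Δ(ρσ) = ρΔσ + 4σ + 4Dσ[x_h]`, `Dρ[x_h] = 2ρ`, `Δρ = 4`.)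
[folklore] -/
theorem template_quotient_eq {σ : EuclideanSpace ℝ (Fin 3) → ℝ} (hσ : ContDiff ℝ 2 σ)
    {x : EuclideanSpace ℝ (Fin 3)} (hx : x 0 ^ 2 + x 1 ^ 2 ≠ 0) {σ' R ν : ℝ}
    {c : EuclideanSpace ℝ (Fin 3)}
    (h : (x 0 ^ 2 + x 1 ^ 2) * σ' +
        fderiv ℝ (fun y : EuclideanSpace ℝ (Fin 3) => (y 0 ^ 2 + y 1 ^ 2) * σ y) x c =
      ν * ((Δ (fun y : EuclideanSpace ℝ (Fin 3) => (y 0 ^ 2 + y 1 ^ 2) * σ y)) x -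
        2 / (x 0 ^ 2 + x 1 ^ 2) *
          fderiv ℝ (fun y : EuclideanSpace ℝ (Fin 3) => (y 0 ^ 2 + y 1 ^ 2) * σ y) x
            ((x 0) • EuclideanSpace.single 0 1 + (x 1) • EuclideanSpace.single 1 1)) + R) :
    σ' + fderiv ℝ σ x c + 2 * σ x * (x 0 * c 0 + x 1 * c 1) / (x 0 ^ 2 + x 1 ^ 2) =
      ν * ((Δ σ) x + 2 / (x 0 ^ 2 + x 1 ^ 2) *
        fderiv ℝ σ x ((x 0) • EuclideanSpace.single 0 1 + (x 1) • EuclideanSpace.single 1 1)) +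
        R / (x 0 ^ 2 + x 1 ^ 2) := by
  set ρf : EuclideanSpace ℝ (Fin 3) → ℝ := fun y => y 0 ^ 2 + y 1 ^ 2 with hρf
  set xh : EuclideanSpace ℝ (Fin 3) :=
    (x 0) • EuclideanSpace.single 0 1 + (x 1) • EuclideanSpace.single 1 1 with hxh
  have hρ2 : ContDiff ℝ 2 ρf := contDiff_horizSq
  have hρd : DifferentiableAt ℝ ρf x := (hρ2.differentiable two_ne_zero) x
  have hσd : DifferentiableAt ℝ σ x := (hσ.differentiable two_ne_zero) x
  -- first derivatives of the product
  have hD : ∀ v : EuclideanSpace ℝ (Fin 3), fderiv ℝ (fun y => ρf y * σ y) x v =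
      2 * (x 0 * v 0 + x 1 * v 1) * σ x + (x 0 ^ 2 + x 1 ^ 2) * fderiv ℝ σ x v := by
    intro v
    rw [fderiv_fun_mul hρd hσd]
    simp [hρf, fderiv_rho_apply]
    ring
  have hxh_apply : xh 0 = x 0 ∧ xh 1 = x 1 := by
    constructor <;> simp [hxh]
  -- the Laplacian of the product
  classical
  have hΔ : (Δ (fun y => ρf y * σ y)) x =
      (x 0 ^ 2 + x 1 ^ 2) * (Δ σ) x + 4 * σ x + 4 * fderiv ℝ σ x xh := by
    rw [laplacian_mul_eq (EuclideanSpace.basisFun (Fin 3) ℝ) hρ2 hσ x, laplacian_rho,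
      sum_fderiv_rho_mul_fderiv σ x]
    simp only [hρf]
    ring
  -- substitute and divide by `ρ`
  have h' := h
  simp only [] at h'
  rw [hD c, hD xh, hΔ, hxh_apply.1, hxh_apply.2] at h'
  have hρx : (x 0 * x 0 + x 1 * x 1) = x 0 ^ 2 + x 1 ^ 2 := by ring
  field_simp
  field_simp at h'
  nlinarith [h', hx, sq_nonneg (x 0), sq_nonneg (x 1)]

end Template

/-! ### The time derivative of an axisymmetric field -/

section TimeDeriv

variable {S : Set ℝ} {v : ℝ → EuclideanSpace ℝ (Fin 3) → EuclideanSpace ℝ (Fin 3)}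

/-- The one-sided time derivative of an axisymmetric jointly smooth field is axisymmetric
(`R_θ` is linear and continuous). [folklore] -/
theorem IsSmoothSpaceTimeOn.isAxisymmetric_timeDerivWithin (h : IsSmoothSpaceTimeOn S v)
    (hax : ∀ s ∈ S, IsAxisymmetric (v s)) {t : ℝ} (ht : t ∈ S) :
    IsAxisymmetric (FluidPDE.timeDerivWithin S v t) := by
  intro θ x
  simp only [timeDerivWithin_apply]
  rw [derivWithin_congr (f := fun s => rotZL θ (v s x)) (fun s hs => by
    show v s (rotZ θ x) = rotZL θ (v s x)
    rw [rotZL_apply, hax s hs θ x]) (by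
    show v t (rotZ θ x) = rotZL θ (v t x)
    rw [rotZL_apply, hax t ht θ x]),
    derivWithin_clm_comp_apply (rotZL θ) (h.differentiableWithinAt_time ht x), rotZL_apply]

/-- The slices of the time derivative of a jointly smooth field are smooth. [folklore] -/
theorem IsSmoothSpaceTimeOn.contDiff_timeDerivWithin_slice (h : IsSmoothSpaceTimeOn S v)
    (hS : UniqueDiffOn ℝ S) {t : ℝ} (ht : t ∈ S) :
    ContDiff ℝ ∞ (FluidPDE.timeDerivWithin S v t) :=
  (h.timeDerivWithin hS).contDiff_slice ht

/-- `∂ₜΓ = swirl (∂ₜu)`: the time derivative of the swirl is the swirl of the time derivative.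
[folklore] -/
theorem IsSmoothSpaceTimeOn.timeDerivWithin_swirl_eq_swirl (h : IsSmoothSpaceTimeOn S v)
    {t : ℝ} (ht : t ∈ S) (x : EuclideanSpace ℝ (Fin 3)) :
    FluidPDE.timeDerivWithin S (fun s => swirl (v s)) t x =
      swirl (FluidPDE.timeDerivWithin S v t) x := by
  rw [timeDerivWithin_swirl h ht x, swirl_eq_inner_rotGen]

end TimeDeriv

/-! ### The `Φ`-equation -/

section PhiEquation

variable {S : Set ℝ} {ν : ℝ} {v : ℝ → EuclideanSpace ℝ (Fin 3) → EuclideanSpace ℝ (Fin 3)}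
  {q : ℝ → EuclideanSpace ℝ (Fin 3) → ℝ}

/-- `e_r (x) = r⁻¹ x_h` with `x_h = x₀e₀ + x₁e₁`. [folklore] -/
theorem eR_eq_inv_smul_horizontal (x : EuclideanSpace ℝ (Fin 3)) :
    eR x = (cylRadius x)⁻¹ •
      ((x 0) • EuclideanSpace.single 0 1 + (x 1) • EuclideanSpace.single 1 1) := by
  rw [eR]
  congr 1
  ext i
  fin_cases i <;> simp

/-- **The `Φ`-equation off the axis.** For a classical solution of the unforced system on a time
set `S` of unique differentiability with axisymmetric velocity, at `t ∈ S` and `x` off the axis,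
`Φ' + DΦ[u] = ν (ΔΦ + 2 radDerivQuot Φ) − 2 W Φ` with `Φ = angVelQuot (u t)`,
`Φ' = angVelQuot (∂ₜu) (x)`, `W = radVelQuot (u t)` (Lei–Zhang 2017, (1.3) divided by `r²`;
Hou–Li 2008, §2). [cite: LeiZhang2017, §1 (1.3) (arXiv p. 3)] -/
theorem IsClassicalNSSolutionOn.angVelQuot_eq_of_ne (hcl : IsClassicalNSSolutionOn S ν 0 v q)
    (hS : UniqueDiffOn ℝ S) (hax : ∀ s ∈ S, IsAxisymmetric (v s)) {t : ℝ} (ht : t ∈ S)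
    {x : EuclideanSpace ℝ (Fin 3)} (hx : cylRadius x ≠ 0) :
    angVelQuot (timeDerivWithin S v t) x + fderiv ℝ (angVelQuot (v t)) x (v t x) =
      ν * ((Δ (angVelQuot (v t))) x + 2 * radDerivQuot (angVelQuot (v t)) x) -
        2 * radVelQuot (v t) x * angVelQuot (v t) x := by
  -- notation and regularity
  have hsm : IsSmoothSpaceTimeOn S v := hcl.smooth_velocity
  have hv : ContDiff ℝ ∞ (v t) := hcl.contDiff_velocity ht
  have hv4 : ContDiff ℝ 4 (v t) := hv.of_le (by norm_cast)
  have hv2 : ContDiff ℝ 2 (v t) := hv.of_le (by norm_cast)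
  have hdv : ContDiff ℝ 2 (timeDerivWithin S v t) :=
    (hsm.contDiff_timeDerivWithin_slice hS ht).of_le (by norm_cast)
  have haxt : IsAxisymmetric (v t) := hax t ht
  have haxdv : IsAxisymmetric (timeDerivWithin S v t) :=
    hsm.isAxisymmetric_timeDerivWithin hax ht
  have hΦ : ContDiff ℝ 2 (angVelQuot (v t)) := contDiff_angVelQuot (n := 2) hv4
  have hΦax : IsAxisymmetricScalar (angVelQuot (v t)) := haxt.isAxisymmetricScalar_angVelQuot hv2
  have hρx : x 0 ^ 2 + x 1 ^ 2 ≠ 0 := by rwa [sq_add_sq_eq_cylRadius_sq, pow_ne_zero_iff two_ne_zero]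
  -- the pressure is axisymmetric, so the swirl equation holds at `(t, x)`
  have hp : ∀ s ∈ S, IsAxisymmetricScalar (q s) := fun s hs =>
    hcl.isAxisymmetricScalar_pressure hS hax (fun _ _ θ y => by ext i; fin_cases i <;> simp) hs
  have hpde := swirl_transport_holds hcl hax hp ht hx
  have hf0 : swirl ((0 : ℝ → EuclideanSpace ℝ (Fin 3) → EuclideanSpace ℝ (Fin 3)) t) x = 0 := by
    simp [swirl]
  rw [hf0, add_zero, convect_apply, partialDeriv_apply, hsm.timeDerivWithin_swirl_eq_swirl ht x,
    eR_eq_inv_smul_horizontal, map_smul, smul_eq_mul] at hpde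
  -- `Γ = ρ Φ` and `swirl (∂ₜu) = ρ Φ'`
  have hΓ : swirl (v t) = fun y => (y 0 ^ 2 + y 1 ^ 2) * angVelQuot (v t) y := by
    funext y
    rw [sq_add_sq_eq_cylRadius_sq, haxt.cylRadius_sq_mul_angVelQuot hv2 y]
  have hΓ' : swirl (timeDerivWithin S v t) x =
      (x 0 ^ 2 + x 1 ^ 2) * angVelQuot (timeDerivWithin S v t) x := by
    rw [sq_add_sq_eq_cylRadius_sq, haxdv.cylRadius_sq_mul_angVelQuot hdv x]
  rw [hΓ, hΓ'] at hpde
  -- the radial term: `2/r * (r⁻¹ * D) = (2/ρ) * D`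
  have hrad : ∀ D : ℝ, 2 / cylRadius x * ((cylRadius x)⁻¹ * D) = 2 / (x 0 ^ 2 + x 1 ^ 2) * D := by
    intro D
    rw [sq_add_sq_eq_cylRadius_sq]
    field_simp
  rw [hrad] at hpde
  -- the template
  have key := template_quotient_eq hΦ hρx (ν := ν) (R := 0) (by rw [add_zero]; exact hpde)
  -- `x₀u₀ + x₁u₁ = ρ W`, `DΦ[x_h] = ρ radDerivQuot Φ`
  rw [zero_div, add_zero, fderiv_apply_horizontal_eq hΦ hΦax, ← sq_add_sq_eq_cylRadius_sq,
    ← haxt.cylRadius_sq_mul_radVelQuot hv2 x, ← sq_add_sq_eq_cylRadius_sq] at key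
  have e1 : 2 * angVelQuot (v t) x * ((x 0 ^ 2 + x 1 ^ 2) * radVelQuot (v t) x) /
      (x 0 ^ 2 + x 1 ^ 2) = 2 * radVelQuot (v t) x * angVelQuot (v t) x := by
    field_simp
  have e2 : 2 / (x 0 ^ 2 + x 1 ^ 2) * ((x 0 ^ 2 + x 1 ^ 2) * radDerivQuot (angVelQuot (v t)) x) =
      2 * radDerivQuot (angVelQuot (v t)) x := by
    field_simp
  rw [e1, e2] at key
  linarith

/-- **The `Φ`-equation on all of `ℝ³`** (Lei–Zhang 2017, (1.3) in the variable `Φ = v^θ/r = Γ/r²`;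
Hou–Li 2008, §2, the `u₁`-equation `∂ₜu₁ + uʳ∂ᵣu₁ + uᶻ∂_z u₁ = (∂ᵣ² + (3/r)∂ᵣ + ∂_z²)u₁ + 2u₁∂_zψ₁`,
`∂_zψ₁ = −uʳ/r`): for a classical solution of the unforced system with viscosity `ν` on a time set
`S` of unique differentiability with axisymmetric velocity, at every `t ∈ S` and EVERY `x`,
`Φ' (x) + DΦ(x)[u] = ν (ΔΦ (x) + 2 radDerivQuot Φ (x)) − 2 W(x) Φ(x)`, where
`Φ = angVelQuot (u t)`, `Φ' = angVelQuot (∂ₜu t)`, `W = radVelQuot (u t)` are the smooth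
quotients `v^θ/r`, `∂ₜ(v^θ/r)`, `vʳ/r` and `2 radDerivQuot Φ = (2/r)∂ᵣΦ` (off the axis by
`angVelQuot_eq_of_ne`; on the axis by continuity of both sides). [cite: LeiZhang2017, §1 (1.3) (arXiv p. 3)] -/
theorem IsClassicalNSSolutionOn.angVelQuot_eq (hcl : IsClassicalNSSolutionOn S ν 0 v q)
    (hS : UniqueDiffOn ℝ S) (hax : ∀ s ∈ S, IsAxisymmetric (v s)) {t : ℝ} (ht : t ∈ S)
    (x : EuclideanSpace ℝ (Fin 3)) :
    angVelQuot (timeDerivWithin S v t) x + fderiv ℝ (angVelQuot (v t)) x (v t x) =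
      ν * ((Δ (angVelQuot (v t))) x + 2 * radDerivQuot (angVelQuot (v t)) x) -
        2 * radVelQuot (v t) x * angVelQuot (v t) x := by
  have hsm : IsSmoothSpaceTimeOn S v := hcl.smooth_velocity
  have hv : ContDiff ℝ ∞ (v t) := hcl.contDiff_velocity ht
  have hv4 : ContDiff ℝ 4 (v t) := hv.of_le (by norm_cast)
  have hv5 : ContDiff ℝ 5 (v t) := hv.of_le (by norm_cast)
  have hv2 : ContDiff ℝ 2 (v t) := hv.of_le (by norm_cast)
  have hdv4 : ContDiff ℝ 4 (timeDerivWithin S v t) :=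
    (hsm.contDiff_timeDerivWithin_slice hS ht).of_le (by norm_cast)
  have hΦ3 : ContDiff ℝ 3 (angVelQuot (v t)) := contDiff_angVelQuot (n := 3) hv5
  have hΦ2 : ContDiff ℝ 2 (angVelQuot (v t)) := contDiff_angVelQuot (n := 2) hv4
  have hΦ' : ContDiff ℝ 2 (angVelQuot (timeDerivWithin S v t)) := contDiff_angVelQuot (n := 2) hdv4
  have hW : ContDiff ℝ 2 (radVelQuot (v t)) := contDiff_radVelQuot (n := 2) hv4
  -- continuity of both sides
  have hL : Continuous fun y => angVelQuot (timeDerivWithin S v t) y +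
      fderiv ℝ (angVelQuot (v t)) y (v t y) :=
    hΦ'.continuous.add (((hΦ2.continuous_fderiv two_ne_zero).clm_apply hv.continuous))
  have hR : Continuous fun y => ν * ((Δ (angVelQuot (v t))) y +
      2 * radDerivQuot (angVelQuot (v t)) y) - 2 * radVelQuot (v t) y * angVelQuot (v t) y := by
    refine (continuous_const.mul ((continuous_laplacian hΦ2).add
      (continuous_const.mul (continuous_radDerivQuot hΦ2)))).sub ?_
    exact (continuous_const.mul hW.continuous).mul hΦ2.continuous
  refine eq_of_eq_off_ker (EuclideanSpace.proj (0 : Fin 3)) ⟨EuclideanSpace.single 0 1, by simp⟩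
    hL hR (fun z hz => ?_) x
  have hz0 : z 0 ≠ 0 := by simpa using hz
  have hzr : cylRadius z ≠ 0 := fun h => hz0 ((cylRadius_eq_zero_iff z).1 h).1
  exact hcl.angVelQuot_eq_of_ne hS hax ht hzr

end PhiEquation

end Literature.Analysis.FluidPDE

end
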